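import Summits.AtomisticToContinuum.HydrodynamicLimit.Theorems.AntiMazurCoboundariesKineticWindowGronwallEndStateBoard
import Summits.AtomisticToContinuum.HydrodynamicLimit.Theorems.AntiMazurCoboundariesKineticWindowGronwallFamilyGlueStub
import Summits.AtomisticToContinuum.HydrodynamicLimit.Theorems.AntiMazurCoboundariesKineticWindowGronwallPlusNode
import HarnessLib

/-!
# End state of line `rare-band-ladder-dock` after lead c5 (v7): the crux from the board crux 14440, ONE profile-wise kinetic wall in
# TwoClocks' vocabulary, and the shared inputs (crux `KineticWindowGronwall`, stmt-AtomisticToContinuum-9282)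

Crux `Summit.AtomisticToContinuum.HydrodynamicLimit.Theses.AntiMazurCoboundaries.KineticWindowGronwall` (`= KineticFluxLdDecay →
RelEntropyVanishing`; shared verbatim with route FluxGibbsianityLdDrude). Lead c4's end state (`Theorems.KineticWindowGronwallEndStateBoard`)
was `EquilibriumFastWindowLD (14440) → LocalTransferE → SharedInputs → crux` with `LocalTransferE` the FAMILY-WISE product wall. Lead c5 proved
the family glue (`Theorems.KineticWindowGronwallFamilyGlue.stub_familyGlue`: thresholds pointwise in the local Gibbs profile upgrade to thresholds
uniform along families) and re-typed the wall in TwoClocks' vocabulary (`Theorems.KineticWindowGronwallPlusNode`): `LocalGibbsTransferPlus :=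
EquilibriumFastWindowLD → KineticWindowLDBoundsUniform`, i.e. TwoClocks' crux `LocalGibbsTransfer` (stmt-14443) strengthened by exactly
{ONE tilt radius `β₀(θ-range, drift bound, σ)` for the normalised general class, window clause `∃τ₀ ∀τ ≥ τ₀`}. THIS FILE records the v7 end
state BY NAME (registered helper stub `stub_cruxOfPlus`):

`EquilibriumFastWindowLD (14440) → LocalGibbsTransferPlus → SharedInputs → KineticWindowGronwall`,

together with `localGibbsTransfer_of_plus : LocalGibbsTransferPlus → TwoClocks.LocalGibbsTransfer` (landed in `…PlusNode`) and the
general-`F` family glue (`…GeneralFamilyGlue`, `…AlongFamiliesDock`: with `TwoProfileTransfer` and 14440 the same wall gives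
OneFlightGossipEngine 16659). So 9282's dependency cone is {14440, LocalGibbsTransferPlus, LCTF, CSCV-W, 16624, 9235, 3091}: board items plus ONE
shared wall, the same wall as 14443's and 16659/16625-S3b's.
-/

noncomputable section

namespace Summit.AtomisticToContinuum.HydrodynamicLimit.Theorems.KineticWindowGronwallEndStateV7

open Summit.AtomisticToContinuum.HydrodynamicLimit.Theses.AntiMazurCoboundaries (KineticWindowGronwall)
open Summit.AtomisticToContinuum.HydrodynamicLimit.Theses.TwoClocks (EquilibriumFastWindowLD)
open Summit.AtomisticToContinuum.HydrodynamicLimit.Theorems.KineticWindowGronwallEndState (SharedInputs)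
open Summit.AtomisticToContinuum.HydrodynamicLimit.Theorems.KineticWindowGronwallPlusNode (LocalGibbsTransferPlus LocalTransferEB
  localTransferEB_of_plus)

/-! ## §1 Statements -/

/-- **THE CRUX FROM THE BOARD AND ONE WALL** (signature of the registered helper stub `stub_cruxOfPlus`):
`EquilibriumFastWindowLD → LocalGibbsTransferPlus → SharedInputs → KineticWindowGronwall`. -/
def CruxOfPlus : Prop :=
  EquilibriumFastWindowLD → LocalGibbsTransferPlus → SharedInputs → KineticWindowGronwall

/-- **THE CRUX FROM THE BOARD AND THE PROFILE-WISE PRODUCT WALL**: `EquilibriumFastWindowLD → LocalTransferEB → SharedInputs →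
KineticWindowGronwall` (`LocalTransferEB := EquilibriumFastWindowLD → LocalQuadraticWindowLDBounds`, weaker than `LocalGibbsTransferPlus`). -/
def CruxOfBoardV7 : Prop :=
  EquilibriumFastWindowLD → LocalTransferEB → SharedInputs → KineticWindowGronwall

/-! ## §2 The end state -/

/-- **v7 END STATE (product wall).** `14440 → LocalTransferEB → SharedInputs → crux`: the glue (`stub_familyGlue`) turns the profile-wise wall into
lead c4's family-wise `LocalTransferE`, and c4's `kineticWindowGronwall_of_board` concludes. [cite: OllaVaradhanYau1993, §2–3] -/
theorem kineticWindowGronwall_of_boardV7 : CruxOfBoardV7 :=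
  fun h₀ h₄ h₇ =>
    KineticWindowGronwallEndStateBoard.kineticWindowGronwall_of_board h₀
      (KineticWindowGronwallFamilyGlue.localTransferE_of_localTransferEB h₄) h₇

/-- **v7 END STATE (one wall, TwoClocks vocabulary).** `14440 → LocalGibbsTransferPlus → SharedInputs → crux`. [cite: OllaVaradhanYau1993, §2–3] -/
theorem kineticWindowGronwall_of_plus : CruxOfPlus :=
  fun h₀ hP h₇ => kineticWindowGronwall_of_boardV7 h₀ (localTransferEB_of_plus hP) h₇

/-- **Registered helper stub `stub_cruxOfPlus`**: the v7 end state of line `rare-band-ladder-dock`. [folklore] -/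
theorem stub_cruxOfPlus : CruxOfPlus :=
  kineticWindowGronwall_of_plus

/-- The same for the item's primary decl (route FluxGibbsianityLdDrude shares stmt-9282 verbatim; same term). [folklore] -/
theorem kineticWindowGronwall_of_plus' (h₀ : EquilibriumFastWindowLD) (hP : LocalGibbsTransferPlus) (h₇ : SharedInputs) :
    Summit.AtomisticToContinuum.HydrodynamicLimit.Theses.FluxGibbsianityLdDrude.KineticWindowGronwall :=
  kineticWindowGronwall_of_plus h₀ hP h₇

end Summit.AtomisticToContinuum.HydrodynamicLimit.Theorems.KineticWindowGronwallEndStateV7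

end
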